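import Mathlib
import Literature.MathematicalPhysics.QuantumFieldTheory.PottsGaugeWilsonLoopTopologyGeneralQ
import HarnessLib

/-!
# The cellular (coupled plaquette percolation) representation of the Potts lattice HIGGS model
# (Eldridge–Forsström–Schweinhart 2026, Thms 5 and 7) — finite torus, PROVED

Source: S. Eldridge, M. P. Forsström, B. Schweinhart, *A Cellular Representation of the Potts
Lattice Higgs Model*, arXiv:2602.22199 (Feb 2026) [EldridgeForsstromSchweinhart2026], read in full
(`lit read arxiv:2602.22199`; loci below are those of v1): §1.1 **Definition 1** (the
`i`-dimensional Potts lattice Higgs model: spins in `ℤ_q` on the `i`-cells, a Potts interaction of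
strength `β₂` on the `(i+1)`-cells and a Potts "external field" of strength `β₁` on the `i`-cells —
for `i = 1` and `q = 2, 3` this is the `ℤ_q` lattice Higgs model in unitary gauge), **Definition 3**
(cochains COMPATIBLE with a pair `(P₂, P₁)` of percolation subcomplexes: `f(ε) = 0` on the open
`i`-cells and `δf(σ) = 0` on the open `(i+1)`-cells; they form the relative cocycle group
`Z^i(P₂, P₁; ℤ_q) = H^i(P₂, P₁; ℤ_q)`, §2.2), **Definition 4** (Coupled Plaquette Percolation, CPP:
`ρ(P₂, P₁) ∝ p₂^{|P₂|}(1-p₂)^{|X^{i+1}|-|P₂|} p₁^{|P₁|}(1-p₁)^{|X^{i}|-|P₁|} |H^i(P₂,P₁;ℤ_q)|`),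
§1.2 **Theorem 5** (the Edwards–Sokal-type coupling `κ(f, P₂, P₁)` with `p₂ = 1 - e^{-β₂}`,
`p₁ = 1 - e^{-β₁}`: marginals = Potts lattice Higgs and CPP; conditionally on the cells `f` is
uniform on `Z^i(P₂,P₁;ℤ_q)`; conditionally on `f` the cells are independent Bernoulli on the
compatible cells), **Definition 6** (`W_γ(f) = e^{2πi f(γ)/q}`; the event `V_γ`: "there exists an
`(i+1)`-chain `τ` so that `γ - ∂τ` is supported on `P₁`", i.e. `[γ] = 0 ∈ H_i(P₂, P₁; ℤ_q)`),
**Theorem 7** (`𝔼_μ(W_γ) = ρ(V_γ)`; the source adds "taking the limit as `β₁ → ∞` recovers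
Theorem 5 of [DS25]" — transcriber's note: it is at `β₁ = 0`, i.e. `p₁ = 0`, no open edges, that
the statement is literally Duncan–Schweinhart's Theorem 5, see `higgsExpect_zero` and
`isRelNullHomologousIn_empty_iff` below), §3.1–3.2 (proofs).

We type the case the tree speaks, exactly as the companion files for the pure gauge theory
(`PottsGaugeEdwardsSokal`, `PottsGaugeWilsonLoopTopology(GeneralQ)`, whose readings (R1)–(R7)
apply verbatim): `i = 1` — the genuine LATTICE HIGGS MODEL, spins on the edges of the discrete
torus `X = 𝕋^d_L` (`θ : Site d L → Fin d → G`), Potts interaction on the plaquettes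
(`res (td₁ θ) σ = 0`), Potts field on the edges (`θ e = 0`) — with coefficients in any finite
additive group `G` for the coupling and in `ℤ_n`, EVERY `n ≥ 1`, for Theorem 7 (the source takes
`q` prime "to keep the required knowledge of algebraic topology to a minimum"; as for the pure gauge
theory, Pontryagin duality replaces linear duality and the identity holds for all `n`, all real
`β₂, β₁` and every `1`-chain `γ`, cycle or not — for a non-closed `γ` the variable `W_γ` is a
Wilson LINE, which is gauge-variant but meaningful in unitary gauge, Def. 6).
`-- TODO(general form): i-cells of a general finite cell complex; general gauge (Cor. 18).`

## Scope (read this first)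

Finite abelian (`ℤ_q`) lattice Higgs model on a finite torus; exact finite-volume identities. Nothing
here bears on the four-dimensional Yang–Mills mass gap or on `BalabanLadder.IR`; in the `ym` ladder
only the conditional finite-`𝕋⁴` rung `BalabanLadder.UV` is closed by any route. Typed for the
`ym-ir` census (graphical representations of lattice gauge theories; Higgs rows), as the `β₁ > 0`
extension of the plaquette random-cluster dictionary of rows A4/A5.

## Contents (everything PROVED; no named fact is introduced)

* Def. 1: `zeroCount`, `higgsHamiltonian`, `higgsWeight`, `higgsPartitionFn`, `higgsProb`,
  `higgsExpect`, normalisation, and `higgsWeight_zero` (`β₁ = 0` is Potts lattice gauge theory);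
* Def. 3 / §2.2: `CppConfig` (pairs `ω = (ω.1, ω.2)` = (open plaquettes, open edges)),
  `IsCompatible`, `vanishingCochains`, `relFlatCochains` (`Z¹(P₂,P₁;M) = H¹(P₂,P₁;M)`),
  lattice identities (`relFlatCochains_sup`, `sup_le_relFlatCochains_inf`), `relCocycleCard`;
* Def. 4: `cppWeight`, `cppPartitionFn`, `cppProb`, `cppEventProb`, positivity, normalisation;
* Thm. 5: `cppCoupling` (`= esWeight × edgeWeight`), `cppCoupling_eq_ite` (conditional law given
  the cells), `sum_cppCoupling_eq_higgsWeight` (first marginal), `sum_cppCoupling_eq_cppWeight`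
  (second marginal), `higgsPartitionFn_eq_cppPartitionFn`;
* Def. 6 / Thm. 7: `IsRelNullHomologousIn` (`V_γ`), `relBoundaryChains`,
  `pairing_eq_zero_of_isRelNullHomologousIn`, `sum_char_pairing_eq_rel` (orthogonality of
  characters on `Z¹(P₂,P₁;ℤ_n)`), `forall_pairing_eq_zero_iff_isRelNullHomologousIn`
  (**`Z¹(P₂,P₁;ℤ_n)^⊥ = {γ : V_γ}`**, Pontryagin duality), and
  **`higgsExpect_wilsonLoopVar_eq_cppEventProb`** — Theorem 7 on `𝕋^d_L` for every `n ≥ 1`;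
  `isRelNullHomologousIn_empty_iff` (at `ω.2 = ∅`, `V_γ` is the pure-gauge event of DS Thm 5).
-/

open Finset

namespace Literature.MathematicalPhysics.QuantumFieldTheory

namespace PlaquetteRC

open LatticeForm

variable {d L : ℕ}

/-! ### The Potts lattice Higgs model on the torus (Definition 1, `i = 1`) -/

section Higgs

variable [NeZero L] (G : Type*) [AddCommGroup G] [DecidableEq G]

/-- The number of edges on which the edge cochain VANISHES, `#{ε ∈ X¹ : f(ε) = 0}` (the Potts
"external field" term of Def. 1 counts these). [cite: EldridgeForsstromSchweinhart2026, §1.1 Def. 1] -/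
def zeroCount (θ : Site d L → Fin d → G) : ℕ :=
  (Finset.univ.filter fun e : Site d L × Fin d => θ e.1 e.2 = 0).card

/-- The Potts lattice Higgs Hamiltonian (Def. 1, `i = 1`):
`𝓗(f) = -β₂ Σ_σ I₀(δf(σ)) - β₁ Σ_ε I₀(f(ε))` (the inverse temperatures are part of `𝓗`; the Gibbs
weight is `e^{-𝓗}`). [cite: EldridgeForsstromSchweinhart2026, §1.1 Def. 1] -/
def higgsHamiltonian (β₂ β₁ : ℝ) (θ : Site d L → Fin d → G) : ℝ :=
  -(β₂ * flatCount G θ + β₁ * zeroCount G θ)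

/-- The Gibbs weight `e^{-𝓗(f)} = e^{β₂ #flat plaquettes + β₁ #zero edges}` of the Potts lattice
Higgs model. [cite: EldridgeForsstromSchweinhart2026, §1.1 Def. 1] -/
noncomputable def higgsWeight (β₂ β₁ : ℝ) (θ : Site d L → Fin d → G) : ℝ :=
  Real.exp (-higgsHamiltonian G β₂ β₁ θ)

/-- `e^{-𝓗(f)} = exp(β₂ flatCount f + β₁ zeroCount f)`. [cite: EldridgeForsstromSchweinhart2026, §1.1 Def. 1] -/
theorem higgsWeight_eq (β₂ β₁ : ℝ) (θ : Site d L → Fin d → G) :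
    higgsWeight G β₂ β₁ θ = Real.exp (β₂ * flatCount G θ + β₁ * zeroCount G θ) := by
  simp [higgsWeight, higgsHamiltonian]

/-- At `β₁ = 0` the Potts lattice Higgs weight is the Potts lattice GAUGE theory weight of the
companion file (`pottsWeight`). [cite: EldridgeForsstromSchweinhart2026, §1.1 (before Def. 2: "the limit … recovers [the pure gauge theory]")] -/
theorem higgsWeight_zero (β₂ : ℝ) (θ : Site d L → Fin d → G) :
    higgsWeight G β₂ 0 θ = pottsWeight G β₂ θ := by
  rw [higgsWeight_eq, pottsWeight_eq, zero_mul, add_zero]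

/-- The Gibbs weights are positive. [cite: EldridgeForsstromSchweinhart2026, §1.1 Def. 1] -/
theorem higgsWeight_pos (β₂ β₁ : ℝ) (θ : Site d L → Fin d → G) : 0 < higgsWeight G β₂ β₁ θ :=
  Real.exp_pos _

variable [Fintype G]

/-- The partition function `Σ_f e^{-𝓗(f)}` of the Potts lattice Higgs model on the torus.
[cite: EldridgeForsstromSchweinhart2026, §1.1 Def. 1] -/
noncomputable def higgsPartitionFn (β₂ β₁ : ℝ) : ℝ :=
  ∑ θ : Site d L → Fin d → G, higgsWeight G β₂ β₁ θ

/-- The partition function is positive. [cite: EldridgeForsstromSchweinhart2026, §1.1 Def. 1] -/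
theorem higgsPartitionFn_pos (β₂ β₁ : ℝ) : 0 < higgsPartitionFn (d := d) (L := L) G β₂ β₁ :=
  Finset.sum_pos (fun θ _ => higgsWeight_pos G β₂ β₁ θ) Finset.univ_nonempty

/-- The Gibbs probability `μ_{β₂,β₁,q,1,𝕋}(f) = e^{-𝓗(f)} / Σ e^{-𝓗}` of one edge cochain.
[cite: EldridgeForsstromSchweinhart2026, §1.1 Def. 1] -/
noncomputable def higgsProb (β₂ β₁ : ℝ) (θ : Site d L → Fin d → G) : ℝ :=
  higgsWeight G β₂ β₁ θ / higgsPartitionFn (d := d) (L := L) G β₂ β₁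

/-- Expectation `𝔼_μ(F)` of a complex observable under the Potts lattice Higgs model.
[cite: EldridgeForsstromSchweinhart2026, §1.1 Def. 1] -/
noncomputable def higgsExpect (β₂ β₁ : ℝ) (F : (Site d L → Fin d → G) → ℂ) : ℂ :=
  ∑ θ : Site d L → Fin d → G, (higgsProb G β₂ β₁ θ : ℂ) * F θ

/-- `μ` is a probability: `Σ_f μ(f) = 1`. [cite: EldridgeForsstromSchweinhart2026, §1.1 Def. 1] -/
theorem sum_higgsProb_eq_one (β₂ β₁ : ℝ) :
    ∑ θ : Site d L → Fin d → G, higgsProb G β₂ β₁ θ = 1 := by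
  unfold higgsProb
  rw [← Finset.sum_div, div_eq_one_iff_eq (higgsPartitionFn_pos G β₂ β₁).ne']
  rfl

/-- At `β₁ = 0` the Potts lattice Higgs expectation is the Potts lattice gauge theory expectation
`pottsExpect` of the companion files. [cite: EldridgeForsstromSchweinhart2026, §1.1 (before Def. 2)] -/
theorem higgsExpect_zero (β₂ : ℝ) (F : (Site d L → Fin d → G) → ℂ) :
    higgsExpect G β₂ 0 F = pottsExpect G β₂ F := by
  unfold higgsExpect pottsExpect higgsProb pottsProb higgsPartitionFn pottsPartitionFn
  simp_rw [higgsWeight_zero]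

end Higgs

/-! ### Pairs of percolation configurations and compatible cochains (Definitions 2–3, §2.2) -/

section Compatible

/-- A CPP configuration on the torus (`i = 1`): the pair `(P₂, P₁)` = (set of open PLAQUETTES,
set of open EDGES); `ω.1` is the `2`-dimensional and `ω.2` the `1`-dimensional percolation
subcomplex (both containing the full lower skeleta, reading (R2)). [cite: EldridgeForsstromSchweinhart2026, §1.1 Def. 2] -/
abbrev CppConfig (d L : ℕ) : Type := Finset (Plaquette d L) × Finset (Site d L × Fin d)

variable {R : Type*} [CommRing R] {M : Type*} [AddCommGroup M] [Module R M]

/-- **Definition 3 (compatibility).** The edge cochain `θ` is compatible with `ω = (P₂, P₁)` if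
`θ(ε) = 0` for every open edge `ε ∈ P₁` and `δθ(σ) = 0` for every open plaquette `σ ∈ P₂`.
[cite: EldridgeForsstromSchweinhart2026, §1.1 Def. 3] -/
abbrev IsCompatible (θ : Site d L → Fin d → M) (ω : CppConfig d L) : Prop :=
  (∀ σ ∈ ω.1, res (td₁ θ) σ = 0) ∧ ∀ e ∈ ω.2, θ e.1 e.2 = 0

variable (R M)

/-- The cochains vanishing on the open edges `P₁` (the relative cochain group `C¹(X, P₁; M)`).
[cite: EldridgeForsstromSchweinhart2026, §2.2 (relative cochains)] -/
def vanishingCochains (ω₁ : Finset (Site d L × Fin d)) : Submodule R (Site d L → Fin d → M) where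
  carrier := {θ | ∀ e ∈ ω₁, θ e.1 e.2 = 0}
  add_mem' := by
    intro a b ha hb e he
    simp only [Pi.add_apply, ha e he, hb e he, add_zero]
  zero_mem' := by
    intro e _
    rfl
  smul_mem' := by
    intro c θ hθ e he
    simp only [Pi.smul_apply, hθ e he, smul_zero]

/-- **The relative cocycle group `Z¹(P₂, P₁; M) = H¹(P₂, P₁; M)`**: the cochains compatible with
`ω = (P₂, P₁)` (flat on the open plaquettes, zero on the open edges). Since `P₂` and `P₁` share their
`0`-skeleton, `C⁰(P₂, P₁) = 0` and the relative cohomology IS the relative cocycle group (§2.2).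
[cite: EldridgeForsstromSchweinhart2026, §1.1 Def. 3 and §2.2] -/
def relFlatCochains (ω : CppConfig d L) : Submodule R (Site d L → Fin d → M) :=
  flatCochains R M ω.1 ⊓ vanishingCochains R M ω.2

variable {R M}

/-- Membership in `Z¹(P₂, P₁; M)` is compatibility (Def. 3). [cite: EldridgeForsstromSchweinhart2026, §1.1 Def. 3] -/
theorem mem_relFlatCochains {ω : CppConfig d L} {θ : Site d L → Fin d → M} :
    θ ∈ relFlatCochains R M ω ↔ IsCompatible θ ω := Iff.rfl

/-- With no open edges the relative cocycles are the cocycles `Z¹(P(ω₂); M)` of the pure gauge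
theory (`flatCochains`). [cite: EldridgeForsstromSchweinhart2026, §4.1 Prop. 20 (first claim)] -/
theorem relFlatCochains_empty_right (ω₂ : Finset (Plaquette d L)) :
    relFlatCochains R M (ω₂, (∅ : Finset (Site d L × Fin d))) = flatCochains R M ω₂ := by
  ext θ
  rw [mem_relFlatCochains, mem_flatCochains]
  exact ⟨fun h => h.1, fun h => ⟨h, fun e he => absurd he (Finset.notMem_empty e)⟩⟩

/-- Opening more cells shrinks `Z¹(P₂, P₁)`: `ω ≤ ω' → Z¹(ω') ≤ Z¹(ω)`. [cite: EldridgeForsstromSchweinhart2026, §4.3 (proof of Prop. 24: "adding a single cell adds a single linear equation")] -/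
theorem relFlatCochains_antitone {ω ω' : CppConfig d L} (h : ω ≤ ω') :
    relFlatCochains R M ω' ≤ relFlatCochains R M ω :=
  fun _ hθ => ⟨fun σ hσ => hθ.1 σ (h.1 hσ), fun e he => hθ.2 e (h.2 he)⟩

/-- `Z¹(P₂ ∪ P₂', P₁ ∪ P₁') = Z¹(P₂, P₁) ⊓ Z¹(P₂', P₁')`. [cite: EldridgeForsstromSchweinhart2026, §4.2 Lemma 21 (proof, Mayer–Vietoris)] -/
theorem relFlatCochains_sup [DecidableEq (Plaquette d L)] (ω ω' : CppConfig d L) :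
    relFlatCochains R M (ω ⊔ ω') = relFlatCochains R M ω ⊓ relFlatCochains R M ω' := by
  ext θ
  simp only [mem_relFlatCochains, IsCompatible, Prod.fst_sup, Prod.snd_sup, Finset.sup_eq_union,
    Finset.mem_union, Submodule.mem_inf]
  constructor
  · intro h
    exact ⟨⟨fun σ hσ => h.1 σ (Or.inl hσ), fun e he => h.2 e (Or.inl he)⟩,
      ⟨fun σ hσ => h.1 σ (Or.inr hσ), fun e he => h.2 e (Or.inr he)⟩⟩
  · intro h
    exact ⟨fun σ hσ => hσ.elim (h.1.1 σ) (h.2.1 σ), fun e he => he.elim (h.1.2 e) (h.2.2 e)⟩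

/-- `Z¹(P₂, P₁) ⊔ Z¹(P₂', P₁') ≤ Z¹(P₂ ∩ P₂', P₁ ∩ P₁')`. [cite: EldridgeForsstromSchweinhart2026, §4.2 Lemma 21 (proof, Mayer–Vietoris)] -/
theorem sup_le_relFlatCochains_inf [DecidableEq (Plaquette d L)] (ω ω' : CppConfig d L) :
    relFlatCochains R M ω ⊔ relFlatCochains R M ω' ≤ relFlatCochains R M (ω ⊓ ω') :=
  sup_le (relFlatCochains_antitone inf_le_left) (relFlatCochains_antitone inf_le_right)

variable (M)

/-- **`|H¹(P₂, P₁; M)| = |Z¹(P₂, P₁; M)|`**, the number of `M`-valued edge cochains compatible with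
`ω` — the CPP weight factor of Definition 4 (a positive integer; `q^{b₁(P₂,P₁;ℤ_q)}` for `M = ℤ_q`,
`q` prime). [cite: EldridgeForsstromSchweinhart2026, §1.1 Def. 4 and §2.2 ("H^i(P₂,P₁) = Z^i(P₂,P₁)")] -/
noncomputable def relCocycleCard (ω : CppConfig d L) : ℕ :=
  Nat.card (relFlatCochains (d := d) (L := L) ℤ M ω)

variable {M}

/-- The filter of compatible cochains counts `Z¹(P₂, P₁; M)`. [cite: EldridgeForsstromSchweinhart2026, §3.1 (proof of Thm. 5, second marginal: "|{f : ∀ε∈P₁, f(ε)=0, ∀σ∈P₂, δf(σ)=0}|")] -/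
theorem card_filter_isCompatible_eq [NeZero L] [Fintype M] [DecidableEq M] (ω : CppConfig d L) :
    (Finset.univ.filter fun θ : Site d L → Fin d → M => IsCompatible θ ω).card =
      relCocycleCard M ω := by
  classical
  rw [relCocycleCard, Nat.card_eq_fintype_card, Fintype.card_subtype]
  congr 1
  ext θ
  simp only [Finset.mem_filter, Finset.mem_univ, true_and, mem_relFlatCochains]

/-- `|Z¹(P₂, P₁; M)| ≥ 1`. [cite: EldridgeForsstromSchweinhart2026, §1.1 Def. 4] -/
theorem relCocycleCard_pos [NeZero L] [Finite M] (ω : CppConfig d L) : 0 < relCocycleCard M ω := by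
  unfold relCocycleCard
  haveI : Finite (relFlatCochains (d := d) (L := L) ℤ M ω) := Subtype.finite
  exact Nat.card_pos

end Compatible

/-! ### Coupled plaquette percolation (Definition 4) -/

section CPP

variable [NeZero L] (M : Type*) [AddCommGroup M] [Fintype M]

/-- **The CPP weight** (Definition 4, `i = 1` on `𝕋^d_L`, coefficients `M`):
`p₂^{|P₂|}(1-p₂)^{|X²|-|P₂|} · p₁^{|P₁|}(1-p₁)^{|X¹|-|P₁|} · |H¹(P₂, P₁; M)|`.
[cite: EldridgeForsstromSchweinhart2026, §1.1 Def. 4] -/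
noncomputable def cppWeight (p₂ p₁ : ℝ) (ω : CppConfig d L) : ℝ :=
  p₂ ^ ω.1.card * (1 - p₂) ^ ω.1ᶜ.card * (p₁ ^ ω.2.card * (1 - p₁) ^ ω.2ᶜ.card) *
    (relCocycleCard M ω : ℝ)

/-- The CPP normalising constant `Σ_ω cppWeight(ω)`. [cite: EldridgeForsstromSchweinhart2026, §1.1 Def. 4] -/
noncomputable def cppPartitionFn (p₂ p₁ : ℝ) : ℝ := ∑ ω : CppConfig d L, cppWeight (d := d) (L := L) M p₂ p₁ ω

/-- The CPP probability `ρ_{p₂,p₁,q,1,𝕋}(P₂, P₁)` (reading R7: a finite Gibbs average).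
[cite: EldridgeForsstromSchweinhart2026, §1.1 Def. 4] -/
noncomputable def cppProb (p₂ p₁ : ℝ) (ω : CppConfig d L) : ℝ :=
  cppWeight M p₂ p₁ ω / cppPartitionFn (d := d) (L := L) M p₂ p₁

open Classical in
/-- `ρ(E)` for an event `E` of CPP configurations. [cite: EldridgeForsstromSchweinhart2026, §1.1 Def. 4] -/
noncomputable def cppEventProb (p₂ p₁ : ℝ) (E : Set (CppConfig d L)) : ℝ :=
  ∑ ω : CppConfig d L, if ω ∈ E then cppProb M p₂ p₁ ω else 0

omit [Fintype M] in
/-- The CPP weights are non-negative for `p₂, p₁ ∈ [0,1]`. [cite: EldridgeForsstromSchweinhart2026, §1.1 Def. 4] -/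
theorem cppWeight_nonneg {p₂ p₁ : ℝ} (hp₂ : p₂ ∈ Set.Icc (0 : ℝ) 1) (hp₁ : p₁ ∈ Set.Icc (0 : ℝ) 1)
    (ω : CppConfig d L) : 0 ≤ cppWeight (d := d) (L := L) M p₂ p₁ ω := by
  unfold cppWeight
  have h2 : 0 ≤ 1 - p₂ := sub_nonneg.mpr hp₂.2
  have h1 : 0 ≤ 1 - p₁ := sub_nonneg.mpr hp₁.2
  have := hp₂.1
  have := hp₁.1
  positivity

/-- The CPP weights are positive for `p₂, p₁ ∈ (0,1)`. [cite: EldridgeForsstromSchweinhart2026, §1.1 Def. 4] -/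
theorem cppWeight_pos {p₂ p₁ : ℝ} (hp₂ : p₂ ∈ Set.Ioo (0 : ℝ) 1) (hp₁ : p₁ ∈ Set.Ioo (0 : ℝ) 1)
    (ω : CppConfig d L) : 0 < cppWeight (d := d) (L := L) M p₂ p₁ ω := by
  unfold cppWeight
  have h2 : 0 < 1 - p₂ := sub_pos.mpr hp₂.2
  have h1 : 0 < 1 - p₁ := sub_pos.mpr hp₁.2
  have := hp₂.1
  have := hp₁.1
  have hc : (0 : ℝ) < (relCocycleCard (d := d) (L := L) M ω : ℝ) := by
    exact_mod_cast relCocycleCard_pos (M := M) ω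
  positivity

/-- `Z_CPP > 0` for `p₂, p₁ ∈ (0,1)`. [cite: EldridgeForsstromSchweinhart2026, §1.1 Def. 4] -/
theorem cppPartitionFn_pos {p₂ p₁ : ℝ} (hp₂ : p₂ ∈ Set.Ioo (0 : ℝ) 1) (hp₁ : p₁ ∈ Set.Ioo (0 : ℝ) 1) :
    0 < cppPartitionFn (d := d) (L := L) M p₂ p₁ :=
  Finset.sum_pos (fun ω _ => cppWeight_pos M hp₂ hp₁ ω) Finset.univ_nonempty

/-- `ρ` is a probability: `Σ_ω ρ(ω) = 1` (`p₂, p₁ ∈ (0,1)`). [cite: EldridgeForsstromSchweinhart2026, §1.1 Def. 4] -/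
theorem sum_cppProb_eq_one {p₂ p₁ : ℝ} (hp₂ : p₂ ∈ Set.Ioo (0 : ℝ) 1) (hp₁ : p₁ ∈ Set.Ioo (0 : ℝ) 1) :
    ∑ ω : CppConfig d L, cppProb M p₂ p₁ ω = 1 := by
  unfold cppProb
  rw [← Finset.sum_div, div_eq_one_iff_eq (cppPartitionFn_pos M hp₂ hp₁).ne']
  rfl

end CPP

/-! ### The coupling (Theorem 5) -/

section Coupling

variable [NeZero L] (G : Type*) [AddCommGroup G] [DecidableEq G]

/-- The EDGE factor of the coupling weight:
`∏_ε [(1-p₁) 1_{ε ∉ P₁} + p₁ 1_{ε ∈ P₁} I₀(f(ε))]`, `p₁ = 1 - e^{-β₁}` (the source's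
`∏_ε [I₀(P₁(ε)) + k₁ P₁(ε) I₀(f(ε))]`, `k₁ = p₁/(1-p₁)`, times the constant `(1-p₁)^{|X¹|}`).
[cite: EldridgeForsstromSchweinhart2026, §1.2 Thm. 5 (definition of κ)] -/
noncomputable def edgeWeight (β₁ : ℝ) (θ : Site d L → Fin d → G) (ω₁ : Finset (Site d L × Fin d)) : ℝ :=
  ∏ e : Site d L × Fin d,
    (if e ∈ ω₁ then esParam β₁ * (if θ e.1 e.2 = 0 then 1 else 0) else 1 - esParam β₁)

/-- **The coupling weight `κ(f, P₂, P₁)`** of Theorem 5 (normalised by the constant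
`(1-p₂)^{|X²|}(1-p₁)^{|X¹|}`): the plaquette factor is the pure-gauge Edwards–Sokal weight `esWeight`
at `β₂`, the edge factor is `edgeWeight` at `β₁`. [cite: EldridgeForsstromSchweinhart2026, §1.2 Thm. 5] -/
noncomputable def cppCoupling (β₂ β₁ : ℝ) (θ : Site d L → Fin d → G) (ω : CppConfig d L) : ℝ :=
  esWeight G β₂ θ ω.1 * edgeWeight G β₁ θ ω.2

/-- `∏_a (if a ∈ s then f a else g a) = ∏_{a ∈ s} f a · ∏_{a ∉ s} g a`. [folklore] -/
private theorem prod_ite_mem_eq' {α : Type*} [Fintype α] [DecidableEq α] (s : Finset α) (f g : α → ℝ) :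
    ∏ a : α, (if a ∈ s then f a else g a) = (∏ a ∈ s, f a) * ∏ a ∈ sᶜ, g a := by
  rw [Finset.prod_ite]
  congr 1
  · exact Finset.prod_congr (by ext a; simp) fun _ _ => rfl
  · exact Finset.prod_congr (by ext a; simp) fun _ _ => rfl

/-- The edge factor is `p₁^{|P₁|}(1-p₁)^{|X¹|-|P₁|}` times the indicator that `f` vanishes on `P₁`.
[cite: EldridgeForsstromSchweinhart2026, §3.1 (proof of Thm. 5, conditional law given the cells)] -/
theorem edgeWeight_eq_ite (β₁ : ℝ) (θ : Site d L → Fin d → G) (ω₁ : Finset (Site d L × Fin d)) :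
    edgeWeight G β₁ θ ω₁ =
      if (∀ e ∈ ω₁, θ e.1 e.2 = 0) then esParam β₁ ^ ω₁.card * (1 - esParam β₁) ^ ω₁ᶜ.card
      else 0 := by
  classical
  unfold edgeWeight
  rw [prod_ite_mem_eq', Finset.prod_mul_distrib, Finset.prod_const, Finset.prod_const,
    Finset.prod_boole]
  split_ifs <;> ring

/-- **Theorem 5, fourth bullet (conditional law given the cells), in weight form**: for fixed
`ω = (P₂, P₁)` the coupling weight is the constant
`p₂^{|P₂|}(1-p₂)^{|X²|-|P₂|} p₁^{|P₁|}(1-p₁)^{|X¹|-|P₁|}` times the INDICATOR that `f` is compatible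
with `(P₂, P₁)` — so `κ(· ∣ P₂, P₁)` is the uniform measure on `Z¹(P₂, P₁; G)`. (The third bullet —
given `f`, the cells are independent Bernoulli(`p₂`), Bernoulli(`p₁`) on the compatible plaquettes
and edges and closed elsewhere — is the product form of the definition of `cppCoupling`.)
[cite: EldridgeForsstromSchweinhart2026, §1.2 Thm. 5 (bullets 3–4) and §3.1] -/
theorem cppCoupling_eq_ite (β₂ β₁ : ℝ) (θ : Site d L → Fin d → G) (ω : CppConfig d L) :
    cppCoupling G β₂ β₁ θ ω =
      if IsCompatible θ ω then
        esParam β₂ ^ ω.1.card * (1 - esParam β₂) ^ ω.1ᶜ.card *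
          (esParam β₁ ^ ω.2.card * (1 - esParam β₁) ^ ω.2ᶜ.card)
      else 0 := by
  unfold cppCoupling IsCompatible
  rw [esWeight_eq_ite, edgeWeight_eq_ite]
  by_cases h1 : ∀ σ ∈ ω.1, res (td₁ θ) σ = 0
  · by_cases h2 : ∀ e ∈ ω.2, θ e.1 e.2 = 0
    · rw [if_pos h1, if_pos h2, if_pos ⟨h1, h2⟩]
    · have h12 : ¬ ((∀ σ ∈ ω.1, res (td₁ θ) σ = 0) ∧ ∀ e ∈ ω.2, θ e.1 e.2 = 0) :=
        fun h => h2 h.2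
      rw [if_neg h2, if_neg h12, mul_zero]
  · have h12 : ¬ ((∀ σ ∈ ω.1, res (td₁ θ) σ = 0) ∧ ∀ e ∈ ω.2, θ e.1 e.2 = 0) :=
      fun h => h1 h.1
    rw [if_neg h1, if_neg h12, zero_mul]

/-- The coupling weight vanishes off compatible pairs. [cite: EldridgeForsstromSchweinhart2026, §3.1 (proof of Thm. 5)] -/
theorem cppCoupling_eq_zero_of_not_isCompatible (β₂ β₁ : ℝ) {θ : Site d L → Fin d → G}
    {ω : CppConfig d L} (h : ¬ IsCompatible θ ω) : cppCoupling G β₂ β₁ θ ω = 0 := by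
  rw [cppCoupling_eq_ite, if_neg h]

/-- Summing the edge factor over the edge configurations:
`Σ_{P₁} ∏_ε [...] = ∏_ε [e^{-β₁} + (1 - e^{-β₁}) I₀(f(ε))] = e^{-β₁|X¹|} e^{β₁ #zero edges}`.
[cite: EldridgeForsstromSchweinhart2026, §3.1 (proof of Thm. 5, first marginal)] -/
theorem sum_edgeWeight_eq (β₁ : ℝ) (θ : Site d L → Fin d → G) :
    ∑ ω₁ : Finset (Site d L × Fin d), edgeWeight G β₁ θ ω₁ =
      Real.exp (-β₁ * Fintype.card (Site d L × Fin d)) * Real.exp (β₁ * zeroCount G θ) := by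
  classical
  have hexp : ∑ ω₁ : Finset (Site d L × Fin d), edgeWeight G β₁ θ ω₁ =
      ∏ e : Site d L × Fin d,
        (esParam β₁ * (if θ e.1 e.2 = 0 then (1 : ℝ) else 0) + (1 - esParam β₁)) := by
    rw [Finset.prod_add, Finset.powerset_univ]
    refine Finset.sum_congr rfl fun ω₁ _ => ?_
    rw [edgeWeight, prod_ite_mem_eq', Finset.compl_eq_univ_sdiff]
  rw [hexp]
  have hfac : ∀ e : Site d L × Fin d,
      esParam β₁ * (if θ e.1 e.2 = 0 then (1 : ℝ) else 0) + (1 - esParam β₁) =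
        if θ e.1 e.2 = 0 then 1 else Real.exp (-β₁) := by
    intro e
    split_ifs <;> simp [esParam]
  simp_rw [hfac]
  rw [Finset.prod_ite, Finset.prod_const_one, one_mul, Finset.prod_const]
  have hcard : (Finset.univ.filter fun e : Site d L × Fin d => ¬ θ e.1 e.2 = 0).card +
      zeroCount G θ = Fintype.card (Site d L × Fin d) := by
    unfold zeroCount
    rw [add_comm, Finset.card_filter_add_card_filter_not]
    rfl
  rw [← Real.exp_nat_mul, ← Real.exp_add]
  congr 1
  have : ((Finset.univ.filter fun e : Site d L × Fin d => ¬ θ e.1 e.2 = 0).card : ℝ) =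
      Fintype.card (Site d L × Fin d) - zeroCount G θ := by
    rw [← hcard]; push_cast; ring
  rw [this]
  ring

/-- **Theorem 5, first bullet (the cochain marginal is the Potts lattice Higgs model)**:
`Σ_{(P₂,P₁)} κ(f, P₂, P₁) = e^{-β₂|X²| - β₁|X¹|} · e^{-𝓗(f)}`. Proof as printed: the sum over pairs
factorises into the plaquette sum (`sum_esWeight_eq_pottsWeight`) and the edge sum
(`sum_edgeWeight_eq`). [cite: EldridgeForsstromSchweinhart2026, §1.2 Thm. 5 (bullet 1) and §3.1 (κ₁)] -/
theorem sum_cppCoupling_eq_higgsWeight (β₂ β₁ : ℝ) (θ : Site d L → Fin d → G) :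
    ∑ ω : CppConfig d L, cppCoupling G β₂ β₁ θ ω =
      Real.exp (-β₂ * Fintype.card (Plaquette d L)) *
        Real.exp (-β₁ * Fintype.card (Site d L × Fin d)) * higgsWeight G β₂ β₁ θ := by
  classical
  unfold cppCoupling
  rw [Fintype.sum_prod_type, ← Finset.sum_mul_sum, sum_esWeight_eq_pottsWeight, sum_edgeWeight_eq,
    pottsWeight_eq, higgsWeight_eq, Real.exp_add]
  ring

variable [Fintype G]

/-- **Theorem 5, second bullet (the cell marginal is the CPP)**:
`Σ_f κ(f, P₂, P₁) = p₂^{|P₂|}(1-p₂)^{|X²|-|P₂|} p₁^{|P₁|}(1-p₁)^{|X¹|-|P₁|} |Z¹(P₂,P₁;G)|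
= cppWeight(P₂, P₁)` with `p₂ = 1 - e^{-β₂}`, `p₁ = 1 - e^{-β₁}`.
[cite: EldridgeForsstromSchweinhart2026, §1.2 Thm. 5 (bullet 2) and §3.1 (κ₂)] -/
theorem sum_cppCoupling_eq_cppWeight (β₂ β₁ : ℝ) (ω : CppConfig d L) :
    ∑ θ : Site d L → Fin d → G, cppCoupling G β₂ β₁ θ ω =
      cppWeight (d := d) (L := L) G (esParam β₂) (esParam β₁) ω := by
  have h : ∀ θ : Site d L → Fin d → G, cppCoupling G β₂ β₁ θ ω =
      (if IsCompatible θ ω then (1 : ℝ) else 0) *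
        (esParam β₂ ^ ω.1.card * (1 - esParam β₂) ^ ω.1ᶜ.card *
          (esParam β₁ ^ ω.2.card * (1 - esParam β₁) ^ ω.2ᶜ.card)) := by
    intro θ
    rw [cppCoupling_eq_ite]
    split_ifs <;> simp
  simp_rw [h]
  rw [← Finset.sum_mul, mul_comm]
  have hc : (∑ θ : Site d L → Fin d → G, (if IsCompatible θ ω then (1 : ℝ) else 0)) =
      (relCocycleCard G ω : ℝ) := by
    rw [← card_filter_isCompatible_eq (M := G) ω, Finset.card_filter]
    push_cast
    rfl
  rw [hc, cppWeight]

/-- **Both marginals at once**: `e^{-β₂|X²| - β₁|X¹|} · Z_Higgs(β₂, β₁) = Z_CPP(1-e^{-β₂}, 1-e^{-β₁})`.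
[cite: EldridgeForsstromSchweinhart2026, §1.2 Thm. 5 (bullets 1–2)] -/
theorem higgsPartitionFn_eq_cppPartitionFn (β₂ β₁ : ℝ) :
    Real.exp (-β₂ * Fintype.card (Plaquette d L)) * Real.exp (-β₁ * Fintype.card (Site d L × Fin d)) *
        higgsPartitionFn (d := d) (L := L) G β₂ β₁ =
      cppPartitionFn (d := d) (L := L) G (esParam β₂) (esParam β₁) := by
  classical
  unfold higgsPartitionFn cppPartitionFn
  rw [Finset.mul_sum]
  simp_rw [← sum_cppCoupling_eq_higgsWeight]
  rw [Finset.sum_comm]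
  exact Finset.sum_congr rfl fun ω _ => sum_cppCoupling_eq_cppWeight G β₂ β₁ ω

/-- `Z_CPP(1-e^{-β₂}, 1-e^{-β₁}) > 0` for all real `β₂, β₁` (through the coupling; for
`β₂, β₁ > 0` also directly from `cppPartitionFn_pos`). [cite: EldridgeForsstromSchweinhart2026, §1.2 Thm. 5] -/
theorem cppPartitionFn_esParam_pos (β₂ β₁ : ℝ) :
    0 < cppPartitionFn (d := d) (L := L) G (esParam β₂) (esParam β₁) := by
  rw [← higgsPartitionFn_eq_cppPartitionFn]
  exact mul_pos (mul_pos (Real.exp_pos _) (Real.exp_pos _)) (higgsPartitionFn_pos G β₂ β₁)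

end Coupling

/-! ### The event `V_γ` and relative boundaries (Definition 6) -/

section RelativeBoundaries

variable [NeZero L] (R : Type*) [CommRing R]

/-- **The event `V_γ` of Definition 6**: "there exists a `2`-chain `τ` (supported on the open
plaquettes `P₂`) so that `γ - ∂τ` is supported on `P₁`", i.e. `[γ] = 0 ∈ H₁(P₂, P₁; R)`.
[cite: EldridgeForsstromSchweinhart2026, §1.2 Def. 6 (V_γ)] -/
def IsRelNullHomologousIn (ω : CppConfig d L) (γ : Site d L → Fin d → R) : Prop :=
  ∃ c : Plaquette d L → R, (∀ σ, σ ∉ ω.1 → c σ = 0) ∧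
    ∀ e : Site d L × Fin d, e ∉ ω.2 → γ e.1 e.2 = bd₂ c e.1 e.2

variable {R} in
/-- With no open edges, `V_γ` is the pure-gauge event "`γ` is null-homologous in `P(ω₂)`" of
Duncan–Schweinhart's Theorem 5 (`IsNullHomologousIn`). [cite: EldridgeForsstromSchweinhart2026, §1.2 (before Thm. 7: "recovers Theorem 5 of [DS25]")] -/
theorem isRelNullHomologousIn_empty_iff (ω₂ : Finset (Plaquette d L)) (γ : Site d L → Fin d → R) :
    IsRelNullHomologousIn R (ω₂, (∅ : Finset (Site d L × Fin d))) γ ↔ IsNullHomologousIn ω₂ γ := by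
  constructor
  · rintro ⟨c, hc, hγ⟩
    refine ⟨c, hc, ?_⟩
    funext x k
    exact (hγ (x, k) (Finset.notMem_empty _)).symm
  · rintro ⟨c, hc, rfl⟩
    exact ⟨c, hc, fun e _ => rfl⟩

/-- `V_γ` is monotone in the configuration (an increasing event). [cite: EldridgeForsstromSchweinhart2026, §1.2 (after Def. 6: "V_γ is an increasing event")] -/
theorem IsRelNullHomologousIn.mono {ω ω' : CppConfig d L} (h : ω ≤ ω') {γ : Site d L → Fin d → R}
    (hγ : IsRelNullHomologousIn R ω γ) : IsRelNullHomologousIn R ω' γ := by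
  obtain ⟨c, hc, hγ⟩ := hγ
  exact ⟨c, fun σ hσ => hc σ (fun h' => hσ (h.1 h')), fun e he => hγ e (fun h' => he (h.2 h'))⟩

/-- The relative boundaries `B₁(P₂, P₁; R) = {γ : [γ] = 0 ∈ H₁(P₂,P₁;R)} = C₁(P₁) + ∂C₂(P₂)` as an
`R`-submodule of the `1`-chains. [cite: EldridgeForsstromSchweinhart2026, §2.2 (relative homology) and Def. 6] -/
def relBoundaryChains (ω : CppConfig d L) : Submodule R (Site d L → Fin d → R) where
  carrier := {γ | IsRelNullHomologousIn R ω γ}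
  add_mem' := by
    rintro a b ⟨c, hc, ha⟩ ⟨c', hc', hb⟩
    refine ⟨c + c', fun σ hσ => by rw [Pi.add_apply, hc σ hσ, hc' σ hσ, add_zero], fun e he => ?_⟩
    simp only [Pi.add_apply, ha e he, hb e he, bd₂, add_mul, Finset.sum_add_distrib]
  zero_mem' := by
    refine ⟨0, fun _ _ => rfl, fun e _ => ?_⟩
    simp only [Pi.zero_apply, bd₂, zero_mul, Finset.sum_const_zero]
  smul_mem' := by
    rintro r a ⟨c, hc, ha⟩
    refine ⟨r • c, fun σ hσ => by rw [Pi.smul_apply, hc σ hσ, smul_zero], fun e he => ?_⟩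
    simp only [Pi.smul_apply, smul_eq_mul, ha e he, bd₂, mul_assoc, Finset.mul_sum]

variable {R}

/-- Membership in `relBoundaryChains`. [cite: EldridgeForsstromSchweinhart2026, Def. 6] -/
theorem mem_relBoundaryChains {ω : CppConfig d L} {γ : Site d L → Fin d → R} :
    γ ∈ relBoundaryChains R ω ↔ IsRelNullHomologousIn R ω γ := Iff.rfl

/-- `∂𝟙_σ ∈ B₁(P₂, P₁)` for an open plaquette `σ ∈ P₂`. [cite: EldridgeForsstromSchweinhart2026, §3.2 (proof of Thm. 7: γ = σ + ∂τ)] -/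
theorem bd₂_plaqInd_mem_relBoundaryChains [DecidableEq (Plaquette d L)] {ω : CppConfig d L}
    {σ : Plaquette d L} (hσ : σ ∈ ω.1) : bd₂ (plaqInd (R := R) σ) ∈ relBoundaryChains R ω :=
  ⟨plaqInd σ, fun τ hτ => by simp [plaqInd, show τ ≠ σ from fun h => hτ (h ▸ hσ)], fun _ _ => rfl⟩

/-- `𝟙_ε ∈ B₁(P₂, P₁)` for an open edge `ε ∈ P₁`. [cite: EldridgeForsstromSchweinhart2026, §3.2 (proof of Thm. 7: γ = σ + ∂τ with σ ∈ C_i(P₁))] -/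
theorem edgeInd_mem_relBoundaryChains {ω : CppConfig d L} {x : Site d L} {k : Fin d}
    (he : (x, k) ∈ ω.2) : edgeInd (R := R) x k ∈ relBoundaryChains R ω := by
  refine ⟨0, fun _ _ => rfl, fun e he' => ?_⟩
  have hne : ¬ (e.1 = x ∧ e.2 = k) := by
    rintro ⟨h1, h2⟩
    exact he' (by rw [show e = (x, k) from Prod.ext h1 h2]; exact he)
  simp only [edgeInd, if_neg hne, bd₂, Pi.zero_apply, zero_mul, Finset.sum_const_zero]

/-- `⟨θ, 𝟙_ε⟩ = θ(ε)`. [cite: EldridgeForsstromSchweinhart2026, §2.1 (evaluating cochains on chains)] -/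
theorem pairing_edgeInd_right (θ : Site d L → Fin d → R) (x : Site d L) (k : Fin d) :
    pairing θ (edgeInd (R := R) x k) = θ x k := by
  unfold pairing edgeInd
  simp only [mul_ite, mul_one, mul_zero]
  rw [Finset.sum_eq_single x]
  · rw [Finset.sum_eq_single k]
    · simp
    · intro l _ hl; simp [hl]
    · intro h; exact absurd (Finset.mem_univ k) h
  · intro y _ hy; exact Finset.sum_eq_zero fun l _ => by simp [hy]
  · intro h; exact absurd (Finset.mem_univ x) h

/-- Compatible cochains annihilate relative boundaries (the easy half of Theorem 7: on `V_γ`,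
`f(γ) = f(σ) + δf(τ) = 0 + 0`). [cite: EldridgeForsstromSchweinhart2026, §3.2 (proof of Thm. 7, case [γ] = 0)] -/
theorem pairing_eq_zero_of_isRelNullHomologousIn {M : Type*} [CommRing M] {ω : CppConfig d L}
    {θ γ : Site d L → Fin d → M} (hθ : IsCompatible θ ω) (hγ : IsRelNullHomologousIn M ω γ) :
    pairing θ γ = 0 := by
  obtain ⟨c, hc, hγc⟩ := hγ
  -- `⟨θ, γ⟩ = ⟨θ, γ - ∂c⟩ + ⟨θ, ∂c⟩`, and both vanish
  have h1 : pairing θ (bd₂ c) = 0 :=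
    pairing_eq_zero_of_isNullHomologousIn (R := M) (mem_flatCochains.mpr hθ.1) ⟨c, hc, rfl⟩
  have h2 : pairing θ γ = pairing θ (bd₂ c) + ∑ x : Site d L, ∑ k : Fin d,
      θ x k * (γ x k - bd₂ c x k) := by
    unfold pairing
    rw [← Finset.sum_add_distrib]
    refine Finset.sum_congr rfl fun x _ => ?_
    rw [← Finset.sum_add_distrib]
    refine Finset.sum_congr rfl fun k _ => ?_
    ring
  rw [h2, h1, zero_add]
  refine Finset.sum_eq_zero fun x _ => Finset.sum_eq_zero fun k _ => ?_
  by_cases he : (x, k) ∈ ω.2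
  · rw [hθ.2 (x, k) he, zero_mul]
  · rw [hγc (x, k) he, sub_self, mul_zero]

end RelativeBoundaries

/-! ### Characters: orthogonality on `Z¹(P₂,P₁;ℤ_n)` and Pontryagin duality -/

section Characters

variable [NeZero L] {n : ℕ} [NeZero n]

/-- **Orthogonality of characters on the relative cocycle group** (the computation behind
`𝔼(W_γ ∣ P₂, P₁) = 𝟙_{V_γ}` in the proof of Theorem 7, where it is phrased through a basis of
`H^i(P₂,P₁;ℤ_q)` and i.i.d. uniform coefficients): summing `e^{2πi f(γ)/n}` over the cochains `f`
compatible with `ω` gives `|Z¹(P₂,P₁;ℤ_n)|` if every compatible cochain annihilates `γ`, and `0`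
otherwise (shift the sum by a compatible `f₀` with `f₀(γ) ≠ 0`). [cite: EldridgeForsstromSchweinhart2026, §3.2 (proof of Thm. 7)] -/
theorem sum_char_pairing_eq_rel (ω : CppConfig d L) (γ : Site d L → Fin d → ZMod n) :
    (∑ θ : Site d L → Fin d → ZMod n,
        (if IsCompatible θ ω then (ZMod.stdAddChar (pairing θ γ) : ℂ) else 0)) =
      if (∀ θ : Site d L → Fin d → ZMod n, IsCompatible θ ω → pairing θ γ = 0) then
        (relCocycleCard (ZMod n) ω : ℂ)
      else 0 := by
  classical
  set Z := relFlatCochains (d := d) (L := L) (ZMod n) (ZMod n) ω with hZ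
  have hmemZ : ∀ θ : Site d L → Fin d → ZMod n, θ ∈ Z ↔ IsCompatible θ ω :=
    fun θ => mem_relFlatCochains
  split_ifs with hall
  · rw [← card_filter_isCompatible_eq, Finset.card_filter]
    push_cast
    refine Finset.sum_congr rfl fun θ _ => ?_
    by_cases hθ : IsCompatible θ ω
    · rw [if_pos hθ, if_pos hθ, hall θ hθ, AddChar.map_zero_eq_one]
    · rw [if_neg hθ, if_neg hθ]
  · push Not at hall
    obtain ⟨θ₀, hθ₀, hne⟩ := hall
    have hθ₀Z : θ₀ ∈ Z := (hmemZ θ₀).mpr hθ₀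
    set S := ∑ θ : Site d L → Fin d → ZMod n,
      (if IsCompatible θ ω then (ZMod.stdAddChar (pairing θ γ) : ℂ) else 0) with hS
    have hshift : S = ZMod.stdAddChar (pairing θ₀ γ) * S := by
      rw [hS, Finset.mul_sum]
      rw [← Equiv.sum_comp (Equiv.addRight θ₀)]
      refine Finset.sum_congr rfl fun θ _ => ?_
      simp only [Equiv.coe_addRight]
      have hmem : (θ + θ₀ ∈ Z) ↔ θ ∈ Z :=
        ⟨fun h => by simpa using Z.sub_mem h hθ₀Z, fun h => Z.add_mem h hθ₀Z⟩
      by_cases hθ : IsCompatible θ ω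
      · have h' : IsCompatible (θ + θ₀) ω := (hmemZ _).mp (hmem.mpr ((hmemZ θ).mpr hθ))
        rw [if_pos h', if_pos hθ, pairing_add_left, AddChar.map_add_eq_mul, mul_comm]
      · have h' : ¬ IsCompatible (θ + θ₀) ω :=
          fun h => hθ ((hmemZ θ).mp (hmem.mp ((hmemZ _).mpr h)))
        rw [if_neg h', if_neg hθ, mul_zero]
    have hψ : (ZMod.stdAddChar (pairing θ₀ γ) : ℂ) ≠ 1 := by
      intro h
      apply hne
      have h0 : (ZMod.stdAddChar (pairing θ₀ γ) : ℂ) = ZMod.stdAddChar (0 : ZMod n) := by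
        rw [h, AddChar.map_zero_eq_one]
      exact ZMod.injective_stdAddChar h0
    have : (1 - ZMod.stdAddChar (pairing θ₀ γ)) * S = 0 := by
      rw [sub_mul, one_mul, ← hshift, sub_self]
    rcases mul_eq_zero.mp this with h | h
    · exact absurd (sub_eq_zero.mp h).symm hψ
    · exact h

/-- An additive character turns finite sums into products. [folklore] -/
private theorem addChar_map_sum' {A B : Type*} [AddCommMonoid A] [CommMonoid B] (ψ : AddChar A B)
    {ι : Type*} (s : Finset ι) (f : ι → A) : ψ (∑ i ∈ s, f i) = ∏ i ∈ s, ψ (f i) := by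
  classical
  induction s using Finset.induction_on with
  | empty => simp
  | insert a s ha ih => rw [Finset.sum_insert ha, Finset.prod_insert ha, AddChar.map_add_eq_mul, ih]

/-- Every complex character of `ℤ_n` is `y ↦ e^{2πi t y/n}` for some `t` (`stdAddChar` is
primitive, so `t ↦ stdAddChar(t ·)` is a bijection onto the dual group). [folklore] -/
private theorem exists_mulShift_eq' (χ : AddChar (ZMod n) ℂ) :
    ∃ t : ZMod n, ∀ y : ZMod n, ZMod.stdAddChar (t * y) = χ y := by
  classical
  have hinj : Function.Injective (ZMod.stdAddChar (N := n)).mulShift :=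
    AddChar.to_mulShift_inj_of_isPrimitive (ZMod.isPrimitive_stdAddChar n)
  have hbij : Function.Bijective (ZMod.stdAddChar (N := n)).mulShift := by
    rw [Fintype.bijective_iff_injective_and_card]
    exact ⟨hinj, (AddChar.card_eq (α := ZMod n)).symm⟩
  obtain ⟨t, ht⟩ := hbij.2 χ
  refine ⟨t, fun y => ?_⟩
  rw [← ht, AddChar.mulShift_apply]

/-- Every complex character of `C¹(𝕋^d_L; ℤ_n)` is `γ ↦ e^{2πi ⟨θ, γ⟩/n}` for a cochain `θ`
(edge by edge, then expand `γ = Σ_e γ(e) 𝟙_e`). [folklore] -/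
private theorem exists_cochain_of_addChar' (χ : AddChar (Site d L → Fin d → ZMod n) ℂ) :
    ∃ θ : Site d L → Fin d → ZMod n, ∀ γ : Site d L → Fin d → ZMod n,
      χ γ = ZMod.stdAddChar (pairing θ γ) := by
  classical
  have hedge : ∀ (x : Site d L) (k : Fin d), ∃ t : ZMod n, ∀ y : ZMod n,
      ZMod.stdAddChar (t * y) = χ (y • edgeInd (R := ZMod n) x k) := by
    intro x k
    obtain ⟨t, ht⟩ := exists_mulShift_eq'
      (χ.compAddMonoidHom (LinearMap.toSpanSingleton (ZMod n) (Site d L → Fin d → ZMod n)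
        (edgeInd (R := ZMod n) x k)).toAddMonoidHom)
    exact ⟨t, fun y => by rw [ht y]; rfl⟩
  choose θ hθ using hedge
  refine ⟨θ, fun γ => ?_⟩
  conv_lhs => rw [← sum_smul_edgeInd γ]
  rw [addChar_map_sum']
  simp_rw [addChar_map_sum', ← hθ]
  unfold pairing
  rw [addChar_map_sum']
  simp_rw [addChar_map_sum']

/-- **`Z¹(P₂, P₁; ℤ_n)^⊥ = B₁(P₂, P₁; ℤ_n)` for every `n ≥ 1`** (the universal-coefficient step
of the proof of Theorem 7 — "there exists a dual `[γ]^* ∈ H^i(P₂,P₁;ℤ_q)` so that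
`[γ]^*([γ]) = 1`" — here by Pontryagin duality, so that `q` need not be prime): a `ℤ_n` `1`-chain
annihilated by every cochain compatible with `(P₂, P₁)` differs from a boundary `∂τ`, `τ` supported
on `P₂`, by a chain supported on `P₁`; and conversely. If `γ ∉ B₁(P₂,P₁)`, a complex character of
the finite group `C₁/B₁(P₂,P₁)` separates `[γ]` from `0` (`AddChar.exists_apply_ne_zero`); pulled
back to `C₁` it is `e^{2πi⟨θ,·⟩/n}` for a cochain `θ`, which is flat on `P₂` because the character
kills `∂𝟙_σ` (`σ ∈ P₂`) and vanishes on `P₁` because it kills `𝟙_ε` (`ε ∈ P₁`); then `θ(γ) ≠ 0`.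
[cite: EldridgeForsstromSchweinhart2026, §3.2 (proof of Thm. 7, case [γ] ≠ 0)] -/
theorem forall_pairing_eq_zero_iff_isRelNullHomologousIn (ω : CppConfig d L)
    (γ : Site d L → Fin d → ZMod n) :
    (∀ θ : Site d L → Fin d → ZMod n, IsCompatible θ ω → pairing θ γ = 0) ↔
      IsRelNullHomologousIn (ZMod n) ω γ := by
  classical
  refine ⟨fun h => ?_, fun hγ θ hθ => pairing_eq_zero_of_isRelNullHomologousIn hθ hγ⟩
  by_contra hγ
  set B : AddSubgroup (Site d L → Fin d → ZMod n) := (relBoundaryChains (ZMod n) ω).toAddSubgroup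
    with hB
  have hmemB : ∀ c, c ∈ B ↔ IsRelNullHomologousIn (ZMod n) ω c := fun c => Iff.rfl
  have hne : (QuotientAddGroup.mk γ : (Site d L → Fin d → ZMod n) ⧸ B) ≠ 0 := by
    intro h0
    exact hγ ((hmemB γ).mp ((QuotientAddGroup.eq_zero_iff γ).mp h0))
  obtain ⟨ψ, hψ⟩ := (AddChar.exists_apply_ne_zero
    (α := (Site d L → Fin d → ZMod n) ⧸ B)).mpr hne
  set χ : AddChar (Site d L → Fin d → ZMod n) ℂ := ψ.compAddMonoidHom (QuotientAddGroup.mk' B)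
    with hχ
  have hχB : ∀ c, IsRelNullHomologousIn (ZMod n) ω c → χ c = 1 := by
    intro c hc
    rw [hχ, AddChar.compAddMonoidHom_apply, QuotientAddGroup.mk'_apply,
      (QuotientAddGroup.eq_zero_iff c).mpr ((hmemB c).mpr hc), AddChar.map_zero_eq_one]
  obtain ⟨θ, hθ⟩ := exists_cochain_of_addChar' χ
  -- `θ` is compatible with `ω`
  have hflat : ∀ σ ∈ ω.1, res (td₁ θ) σ = 0 := by
    intro σ hσ
    rw [res_td₁_eq_pairing_bd₂ θ σ]
    have h1 : (ZMod.stdAddChar (pairing θ (bd₂ (plaqInd (R := ZMod n) σ))) : ℂ) =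
        ZMod.stdAddChar (0 : ZMod n) := by
      rw [← hθ, AddChar.map_zero_eq_one]
      exact hχB _ (bd₂_plaqInd_mem_relBoundaryChains (R := ZMod n) hσ)
    exact ZMod.injective_stdAddChar h1
  have hvan : ∀ e ∈ ω.2, θ e.1 e.2 = 0 := by
    intro e he
    rw [← pairing_edgeInd_right θ e.1 e.2]
    have h1 : (ZMod.stdAddChar (pairing θ (edgeInd (R := ZMod n) e.1 e.2)) : ℂ) =
        ZMod.stdAddChar (0 : ZMod n) := by
      rw [← hθ, AddChar.map_zero_eq_one]
      exact hχB _ (edgeInd_mem_relBoundaryChains (R := ZMod n) (x := e.1) (k := e.2) he)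
    exact ZMod.injective_stdAddChar h1
  apply hψ
  have : χ γ = 1 := by
    rw [hθ γ, h θ ⟨hflat, hvan⟩, AddChar.map_zero_eq_one]
  rw [hχ, AddChar.compAddMonoidHom_apply, QuotientAddGroup.mk'_apply] at this
  exact this

end Characters

/-! ### Theorem 7 on the finite torus, every `q ≥ 1` -/

section WilsonLine

variable [NeZero L] (n : ℕ) [NeZero n]

/-- **Theorem 7 (Eldridge–Forsström–Schweinhart 2026) on the finite torus `𝕋^d_L`, PROVED for
every `q = n ≥ 1`.** For all real `β₂, β₁` and every `ℤ_n` `1`-chain `γ`, the Potts lattice Higgs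
expectation of the Wilson line∕loop variable `W_γ(f) = e^{2πi f(γ)/n}` equals the probability, under
coupled plaquette percolation with `p₂ = 1 - e^{-β₂}`, `p₁ = 1 - e^{-β₁}`, of the topological event
`V_γ` ("`γ - ∂τ` is supported on the open edges for some `2`-chain `τ` on the open plaquettes",
`[γ] = 0 ∈ H₁(P₂,P₁;ℤ_n)`): `𝔼_{μ_{β₂,β₁,n}}(W_γ) = ρ_{p₂,p₁,n}(V_γ)`. (Printed for prime `q`,
`β₂, β₁ ≥ 0`, any finite cell complex and any `i`; typed for `i = 1` on the torus, where it holds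
for every `n`, every real `β₂, β₁` and every chain.) Proof as printed: condition on the cells
(Thm. 5), `𝔼(W_γ ∣ P₂,P₁) = 𝟙_{V_γ}` by the character sum over `Z¹(P₂,P₁;ℤ_n)`
(`sum_char_pairing_eq_rel`) and `Z¹(P₂,P₁;ℤ_n)^⊥ = B₁(P₂,P₁;ℤ_n)`
(`forall_pairing_eq_zero_iff_isRelNullHomologousIn`). At `β₁ = 0` (`p₁ = 0`) this is
Duncan–Schweinhart's Theorem 5 ∕ Prop. 14 (`pottsExpect_wilsonLoopVar_eq_eventProbGrp`,
`higgsExpect_zero`, `isRelNullHomologousIn_empty_iff`).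
[cite: EldridgeForsstromSchweinhart2026, §1.2 Thm. 7] -/
theorem higgsExpect_wilsonLoopVar_eq_cppEventProb (β₂ β₁ : ℝ) (γ : Site d L → Fin d → ZMod n) :
    higgsExpect (d := d) (L := L) (ZMod n) β₂ β₁ (wilsonLoopVar n γ) =
      (cppEventProb (d := d) (L := L) (ZMod n) (esParam β₂) (esParam β₁)
        {ω | IsRelNullHomologousIn (ZMod n) ω γ} : ℂ) := by
  classical
  set E : ℝ := Real.exp (-β₂ * Fintype.card (Plaquette d L)) *
    Real.exp (-β₁ * Fintype.card (Site d L × Fin d)) with hE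
  have hEpos : 0 < E := mul_pos (Real.exp_pos _) (Real.exp_pos _)
  have hZpos := higgsPartitionFn_pos (d := d) (L := L) (ZMod n) β₂ β₁
  have hRCpos := cppPartitionFn_esParam_pos (d := d) (L := L) (ZMod n) β₂ β₁
  -- Step 1: numerator `E Σ_f e^{-𝓗(f)} W_γ(f) = Σ_ω cppWeight(ω) 𝟙_{V_γ}(ω)`
  have hnum : (E : ℂ) * ∑ θ : Site d L → Fin d → ZMod n,
      (higgsWeight (ZMod n) β₂ β₁ θ : ℂ) * wilsonLoopVar n γ θ =
      ∑ ω : CppConfig d L,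
        if IsRelNullHomologousIn (ZMod n) ω γ then
          (cppWeight (d := d) (L := L) (ZMod n) (esParam β₂) (esParam β₁) ω : ℂ)
        else 0 := by
    rw [Finset.mul_sum]
    have h1 : ∀ θ : Site d L → Fin d → ZMod n, (E : ℂ) * ((higgsWeight (ZMod n) β₂ β₁ θ : ℂ) *
        wilsonLoopVar n γ θ) = ∑ ω : CppConfig d L,
          (cppCoupling (ZMod n) β₂ β₁ θ ω : ℂ) * wilsonLoopVar n γ θ := by
      intro θ
      rw [← Finset.sum_mul, ← mul_assoc]
      congr 1
      rw [hE]
      exact_mod_cast (sum_cppCoupling_eq_higgsWeight (ZMod n) β₂ β₁ θ).symm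
    simp_rw [h1]
    rw [Finset.sum_comm]
    refine Finset.sum_congr rfl fun ω _ => ?_
    -- for fixed `ω`: `Σ_θ κ(θ,ω) W_γ(θ) = const(ω) Σ_{θ ∈ Z¹(ω)} ψ(θ(γ))`
    have h2 : ∀ θ : Site d L → Fin d → ZMod n,
        (cppCoupling (ZMod n) β₂ β₁ θ ω : ℂ) * wilsonLoopVar n γ θ =
        ((esParam β₂ ^ ω.1.card * (1 - esParam β₂) ^ ω.1ᶜ.card *
            (esParam β₁ ^ ω.2.card * (1 - esParam β₁) ^ ω.2ᶜ.card) : ℝ) : ℂ) *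
          (if IsCompatible θ ω then (ZMod.stdAddChar (pairing θ γ) : ℂ) else 0) := by
      intro θ
      rw [cppCoupling_eq_ite]
      by_cases hθ : IsCompatible θ ω
      · rw [if_pos hθ, if_pos hθ, wilsonLoopVar]
      · rw [if_neg hθ, if_neg hθ]
        simp
    simp_rw [h2]
    rw [← Finset.mul_sum, sum_char_pairing_eq_rel]
    by_cases hV : IsRelNullHomologousIn (ZMod n) ω γ
    · rw [if_pos ((forall_pairing_eq_zero_iff_isRelNullHomologousIn ω γ).mpr hV), if_pos hV,
        cppWeight]
      push_cast
      ring
    · rw [if_neg (fun h => hV ((forall_pairing_eq_zero_iff_isRelNullHomologousIn ω γ).mp h)),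
        if_neg hV]
      simp
  -- Step 2: denominator `E Z_Higgs = Z_CPP`
  have hden : E * higgsPartitionFn (d := d) (L := L) (ZMod n) β₂ β₁ =
      cppPartitionFn (d := d) (L := L) (ZMod n) (esParam β₂) (esParam β₁) :=
    higgsPartitionFn_eq_cppPartitionFn (ZMod n) β₂ β₁
  -- Step 3: assemble
  set Sθ : ℂ := ∑ θ : Site d L → Fin d → ZMod n,
    (higgsWeight (ZMod n) β₂ β₁ θ : ℂ) * wilsonLoopVar n γ θ with hSθ
  set Sω : ℂ := ∑ ω : CppConfig d L,
    (if IsRelNullHomologousIn (ZMod n) ω γ then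
      (cppWeight (d := d) (L := L) (ZMod n) (esParam β₂) (esParam β₁) ω : ℂ) else 0) with hSω
  have hZ0 : (higgsPartitionFn (d := d) (L := L) (ZMod n) β₂ β₁ : ℂ) ≠ 0 := by
    exact_mod_cast hZpos.ne'
  have hRC0 : (cppPartitionFn (d := d) (L := L) (ZMod n) (esParam β₂) (esParam β₁) : ℂ) ≠ 0 := by
    exact_mod_cast hRCpos.ne'
  have hL : higgsExpect (d := d) (L := L) (ZMod n) β₂ β₁ (wilsonLoopVar n γ) =
      Sθ / (higgsPartitionFn (d := d) (L := L) (ZMod n) β₂ β₁ : ℂ) := by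
    unfold higgsExpect higgsProb
    rw [hSθ, Finset.sum_div]
    refine Finset.sum_congr rfl fun θ _ => ?_
    push_cast
    ring
  have hR : (cppEventProb (d := d) (L := L) (ZMod n) (esParam β₂) (esParam β₁)
        {ω | IsRelNullHomologousIn (ZMod n) ω γ} : ℂ) =
      Sω / (cppPartitionFn (d := d) (L := L) (ZMod n) (esParam β₂) (esParam β₁) : ℂ) := by
    unfold cppEventProb cppProb
    rw [Complex.ofReal_sum, hSω, Finset.sum_div]
    refine Finset.sum_congr rfl fun ω _ => ?_
    simp only [Set.mem_setOf_eq]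
    split_ifs <;> simp [Complex.ofReal_div]
  have hdenC : (E : ℂ) * (higgsPartitionFn (d := d) (L := L) (ZMod n) β₂ β₁ : ℂ) =
      (cppPartitionFn (d := d) (L := L) (ZMod n) (esParam β₂) (esParam β₁) : ℂ) := by
    exact_mod_cast hden
  have hE0 : (E : ℂ) ≠ 0 := by exact_mod_cast hEpos.ne'
  rw [hL, hR, div_eq_div_iff hZ0 hRC0]
  have key : (E : ℂ) * (Sθ * (cppPartitionFn (d := d) (L := L) (ZMod n) (esParam β₂) (esParam β₁) : ℂ) -
      Sω * (higgsPartitionFn (d := d) (L := L) (ZMod n) β₂ β₁ : ℂ)) = 0 := by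
    linear_combination ((cppPartitionFn (d := d) (L := L) (ZMod n) (esParam β₂) (esParam β₁) : ℂ)) * hnum -
      Sω * hdenC
  have h0 := (mul_eq_zero.mp key).resolve_left hE0
  exact sub_eq_zero.mp h0

end WilsonLine

end PlaquetteRC

end Literature.MathematicalPhysics.QuantumFieldTheory
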